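import Mathlib.Analysis.InnerProductSpace.GramSchmidtOrtho
import Mathlib.Analysis.InnerProductSpace.PiL2
import HarnessLib

/-!
# Gram–Schmidt commutes with a compatible complex structure; complex Gram–Schmidt as real Gram–Schmidt

Topic `Analysis/Matrix`, companion of `GramSchmidtNearIdentity.lean`. Written for the machine half of
the discharge of Aaronson–Arkhipov's Main Theorem (Theory of Computing 9 (2013), Thm. 1.3; named fact
`Literature.Computability.QuantumComplexity.gpeSolvableInFBPPRel_NPRel_of_approxBosonSamplingOracle`):
the reduction must Gram–Schmidt-orthonormalise the COMPLEX columns of an integer matrix exactly,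
while the tree's exact integer Gram–Schmidt machinery (Cohen's recursion,
`Algebra/EuclideanLattices/LLLIntegral.lean`, and its `FP` machine `LLLMachineTables.lean`) is
REAL. This file reduces complex Gram–Schmidt to real Gram–Schmidt of the doubled family
`(v₀, i v₀, v₁, i v₁, …)`. Everything here is proved, Mathlib only.

## Results

* `IsComplexStructure J` — a real-linear `J` preserving inner products and skew (`⟪J x, x⟫ = 0`);
  then `⟪J x, y⟫ = -⟪x, J y⟫` (`inner_left`), `J² = -1` (`apply_apply`), `‖J x‖ = ‖x‖`, and the
  projection onto a pair `{w, J w}` commutes with `J` (`proj_pair_comm`).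
* `dbl J g = (g₀, J g₀, g₁, J g₁, …)` on `Fin (2n)` (`evenIdx`, `oddIdx`, `sum_Iio_evenIdx`,
  `Iio_oddIdx`), and **`gramSchmidt_dbl`**: `f*_{2i+1} = J f*_{2i}` and
  `f*_{2i} = gᵢ - ∑_{i'<i} (P_{f*_{2i'}} + P_{J f*_{2i'}}) gᵢ` for Mathlib's `gramSchmidt ℝ` of the
  doubled family (strong induction); `norm_gramSchmidt_dbl_oddIdx`.
* `realify : ℂᵐ → ℝ^{m+m}` (real parts, then imaginary parts, through `finSumFinEquiv`) and
  `mulI` (multiplication by `i` transported): `realify (I • v) = mulI (realify v)`,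
  `⟪realify u, realify v⟫ = re ⟪u, v⟫_ℂ` (`inner_realify`), `‖realify v‖ = ‖v‖`, `mulI` is a
  compatible complex structure (`isComplexStructure_mulI`), complex rank-one projections realify
  to projection pairs (`realify_proj`), and **`realify_gramSchmidt`**:
  `realify (gramSchmidt ℂ g i) = gramSchmidt ℝ (dbl mulI (realify ∘ g)) (evenIdx i)`.

So the real Gram determinants / scaled Gram–Schmidt vectors of the doubled realified family, which
the integer recursion computes, carry the complex Gram–Schmidt vectors of the original columns.

## References

* W. Greub, *Linear Algebra*, 4th ed., Springer 1975, Ch. XI §3 (complex structures on real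
  inner product spaces; realification). Standard; proved here.
-/

namespace Literature.Analysis.Matrix

open Finset InnerProductSpace Submodule

section Skew

variable {V : Type*} [NormedAddCommGroup V] [InnerProductSpace ℝ V] {n : ℕ}

local notation "⟪" x ", " y "⟫" => inner ℝ x y

/-- A **compatible complex structure** on a real inner product space: a real-linear map `J` that
preserves inner products and is skew (`⟪J x, x⟫ = 0`) — multiplication by `i` on the realification
of a complex inner product space. [folklore] -/
structure IsComplexStructure (J : V →ₗ[ℝ] V) : Prop where
  /-- `J` preserves the inner product. -/
  isometry : ∀ x y, ⟪J x, J y⟫ = ⟪x, y⟫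
  /-- `J` is skew. -/
  skew : ∀ x, ⟪J x, x⟫ = 0

namespace IsComplexStructure

variable {J : V →ₗ[ℝ] V} (hJ : IsComplexStructure J)
include hJ

/-- Skew-adjointness: `⟪J x, y⟫ = -⟪x, J y⟫` (polarise `⟪J(x+y), x+y⟫ = 0`). [folklore] -/
theorem inner_left (x y : V) : ⟪J x, y⟫ = -⟪x, J y⟫ := by
  have h := hJ.skew (x + y)
  rw [map_add, inner_add_left, inner_add_right, inner_add_right, hJ.skew x, hJ.skew y,
    zero_add, add_zero, real_inner_comm x (J y)] at h
  linarith

/-- `J² = -1` (from skew-adjointness and isometry, by nondegeneracy). [folklore] -/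
theorem apply_apply (x : V) : J (J x) = -x := by
  apply ext_inner_right ℝ
  intro y
  rw [hJ.inner_left, inner_neg_left, hJ.isometry]

/-- `‖J x‖ = ‖x‖`. [folklore] -/
theorem norm_map (x : V) : ‖J x‖ = ‖x‖ := by
  have h := hJ.isometry x x
  rw [real_inner_self_eq_norm_sq, real_inner_self_eq_norm_sq] at h
  nlinarith [norm_nonneg (J x), norm_nonneg x]

/-- The projection onto a `J`-pair commutes with `J`:
`P_w (J x) + P_{Jw} (J x) = J (P_w x + P_{Jw} x)`, where `P_u x = (⟪u, x⟫/‖u‖²) • u`. [folklore] -/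
theorem proj_pair_comm (w x : V) :
    (⟪w, J x⟫ / ‖w‖ ^ 2) • w + (⟪J w, J x⟫ / ‖J w‖ ^ 2) • J w =
      J ((⟪w, x⟫ / ‖w‖ ^ 2) • w + (⟪J w, x⟫ / ‖J w‖ ^ 2) • J w) := by
  rw [hJ.norm_map, hJ.isometry, map_add, map_smul, map_smul, hJ.apply_apply, hJ.inner_left w x,
    real_inner_comm]
  rw [smul_neg, neg_div, neg_smul]
  abel

end IsComplexStructure

/-! ### The doubled family `(g₀, J g₀, g₁, J g₁, …)` -/

/-- The even index `2i`. [folklore] -/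
def evenIdx (i : Fin n) : Fin (2 * n) := ⟨2 * i, by omega⟩

/-- The odd index `2i + 1`. [folklore] -/
def oddIdx (i : Fin n) : Fin (2 * n) := ⟨2 * i + 1, by omega⟩

/-- The doubled family: `f (2i) = g i`, `f (2i+1) = J (g i)`. [folklore] -/
def dbl (J : V →ₗ[ℝ] V) (g : Fin n → V) (l : Fin (2 * n)) : V :=
  if l.val % 2 = 0 then g ⟨l.val / 2, by omega⟩ else J (g ⟨l.val / 2, by omega⟩)

/-- `dbl` at an even index. [folklore] -/
@[simp] theorem dbl_evenIdx (J : V →ₗ[ℝ] V) (g : Fin n → V) (i : Fin n) :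
    dbl J g (evenIdx i) = g i := by
  simp only [dbl, evenIdx, Nat.mul_mod_right, if_true]
  congr 1
  apply Fin.ext
  simp

/-- `dbl` at an odd index. [folklore] -/
@[simp] theorem dbl_oddIdx (J : V →ₗ[ℝ] V) (g : Fin n → V) (i : Fin n) :
    dbl J g (oddIdx i) = J (g i) := by
  simp only [dbl, oddIdx]
  rw [if_neg (by omega)]
  congr 2
  apply Fin.ext
  simp only
  omega

/-- Every index is even or odd. [folklore] -/
theorem eq_evenIdx_or_oddIdx (l : Fin (2 * n)) : ∃ i : Fin n, l = evenIdx i ∨ l = oddIdx i := by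
  refine ⟨⟨l.val / 2, by omega⟩, ?_⟩
  rcases Nat.even_or_odd l.val with ⟨k, hk⟩ | ⟨k, hk⟩
  · left; apply Fin.ext; simp [evenIdx]; omega
  · right; apply Fin.ext; simp [oddIdx]; omega

/-- **Sums below an even index pair up**:
`∑_{l < 2i} F l = ∑_{i' < i} (F (2i') + F (2i'+1))`. [folklore] -/
theorem sum_Iio_evenIdx {M : Type*} [AddCommMonoid M] (F : Fin (2 * n) → M) (i : Fin n) :
    ∑ l ∈ Iio (evenIdx i), F l = ∑ i' ∈ Iio i, (F (evenIdx i') + F (oddIdx i')) := by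
  classical
  rw [Finset.sum_add_distrib]
  have hdisj : Disjoint ((Iio i).image (evenIdx (n := n))) ((Iio i).image (oddIdx (n := n))) := by
    rw [Finset.disjoint_left]
    intro l h1 h2
    simp only [mem_image] at h1 h2
    obtain ⟨a, _, rfl⟩ := h1
    obtain ⟨b, _, hb⟩ := h2
    have := congrArg Fin.val hb
    simp [evenIdx, oddIdx] at this
    omega
  have hunion : Iio (evenIdx i) = (Iio i).image evenIdx ∪ (Iio i).image oddIdx := by
    ext l
    simp only [mem_Iio, mem_union, mem_image]
    constructor
    · intro hl
      have hl' : l.val < 2 * i.val := hl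
      obtain ⟨j, hj | hj⟩ := eq_evenIdx_or_oddIdx l
      · left; refine ⟨j, ?_, hj.symm⟩
        subst hj; change j.val < i.val; simp [evenIdx] at hl'; omega
      · right; refine ⟨j, ?_, hj.symm⟩
        subst hj; change j.val < i.val; simp [oddIdx] at hl'; omega
    · rintro (⟨j, hj, rfl⟩ | ⟨j, hj, rfl⟩)
      · change 2 * j.val < 2 * i.val; have : j.val < i.val := hj; omega
      · change 2 * j.val + 1 < 2 * i.val; have : j.val < i.val := hj; omega
  rw [hunion, Finset.sum_union hdisj,
    Finset.sum_image fun a _ b _ h => by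
      have := congrArg Fin.val h; simp [evenIdx] at this; exact Fin.ext this,
    Finset.sum_image fun a _ b _ h => by
      have := congrArg Fin.val h; simp [oddIdx] at this; exact Fin.ext (by omega)]

/-- The indices below `2i + 1` are those below `2i`, and `2i`. [folklore] -/
theorem Iio_oddIdx (i : Fin n) : Iio (oddIdx i) = insert (evenIdx i) (Iio (evenIdx i)) := by
  ext l
  simp only [mem_Iio, mem_insert]
  constructor
  · intro hl
    have hl' : l.val < 2 * i.val + 1 := hl
    by_cases h : l = evenIdx i
    · left; exact h
    · right
      have : l.val ≠ 2 * i.val := fun h' => h (Fin.ext h')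
      change l.val < 2 * i.val
      omega
  · rintro (rfl | hl)
    · change 2 * i.val < 2 * i.val + 1; omega
    · have : l.val < 2 * i.val := hl
      change l.val < 2 * i.val + 1; omega

/-! ### Gram–Schmidt of the doubled family -/

/-- The rank-one projection `P_u x = (⟪u, x⟫/‖u‖²) • u`. [folklore] -/
noncomputable def proj (u x : V) : V := (⟪u, x⟫ / ‖u‖ ^ 2) • u

/-- Real Gram–Schmidt, unfolded with `proj`. [folklore] -/
theorem gramSchmidt_eq_sub_sum {N : ℕ} (f : Fin N → V) (l : Fin N) :
    gramSchmidt ℝ f l = f l - ∑ l' ∈ Iio l, proj (gramSchmidt ℝ f l') (f l) := by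
  rw [eq_sub_iff_add_eq]
  exact (gramSchmidt_def'' ℝ f l).symm

variable {J : V →ₗ[ℝ] V}

/-- `J` maps a projection pair into the span of the pair: for `w ⊥ v` and `J w ⊥ v`,
`⟪v, J (P_w x + P_{Jw} x)⟫ = 0`. [folklore] -/
theorem inner_map_proj_pair_eq_zero (hJ : IsComplexStructure J) {v w : V} (hw : ⟪v, w⟫ = 0)
    (hJw : ⟪v, J w⟫ = 0) (x : V) : ⟪v, J (proj w x + proj (J w) x)⟫ = 0 := by
  simp only [proj, map_add, map_smul, hJ.apply_apply, inner_add_right, inner_smul_right, inner_neg_right,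
    hw, hJw, mul_zero, neg_zero, add_zero]

/-- **Gram–Schmidt commutes with the complex structure on the doubled family**: with
`f = (g₀, J g₀, g₁, J g₁, …)`,
`f*_{2i+1} = J f*_{2i}` and `f*_{2i} = gᵢ - ∑_{i'<i} (P_{f*_{2i'}} + P_{J f*_{2i'}}) gᵢ`
— the realification of complex Gram–Schmidt (`J` = multiplication by `i`; the two real
projections onto `w` and `J w` add up to the complex projection onto `w`). Strong induction on `i`.
[folklore] -/
theorem gramSchmidt_dbl (hJ : IsComplexStructure J) (g : Fin n → V) :
    ∀ i : Fin n,
      gramSchmidt ℝ (dbl J g) (oddIdx i) = J (gramSchmidt ℝ (dbl J g) (evenIdx i)) ∧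
      gramSchmidt ℝ (dbl J g) (evenIdx i) = g i - ∑ i' ∈ Iio i,
        (proj (gramSchmidt ℝ (dbl J g) (evenIdx i')) (g i) +
          proj (J (gramSchmidt ℝ (dbl J g) (evenIdx i'))) (g i)) := by
  set f := dbl J g with hf
  intro i
  induction i using WellFoundedLT.induction with
  | ind i ih =>
    -- the even vector
    have hE : gramSchmidt ℝ f (evenIdx i) = g i - ∑ i' ∈ Iio i,
        (proj (gramSchmidt ℝ f (evenIdx i')) (g i) + proj (J (gramSchmidt ℝ f (evenIdx i'))) (g i)) := by
      rw [gramSchmidt_eq_sub_sum, hf, dbl_evenIdx, ← hf, sum_Iio_evenIdx]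
      congr 1
      refine Finset.sum_congr rfl fun i' hi' => ?_
      rw [(ih i' (mem_Iio.1 hi')).1]
    refine ⟨?_, hE⟩
    -- the odd vector
    rw [gramSchmidt_eq_sub_sum, hf, dbl_oddIdx, ← hf, Iio_oddIdx, Finset.sum_insert (by simp),
      sum_Iio_evenIdx]
    -- the paired projections commute with `J`
    have hpair : ∑ i' ∈ Iio i, (proj (gramSchmidt ℝ f (evenIdx i')) (J (g i)) +
        proj (gramSchmidt ℝ f (oddIdx i')) (J (g i))) =
        J (∑ i' ∈ Iio i, (proj (gramSchmidt ℝ f (evenIdx i')) (g i) +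
          proj (J (gramSchmidt ℝ f (evenIdx i'))) (g i))) := by
      rw [map_sum]
      refine Finset.sum_congr rfl fun i' hi' => ?_
      rw [(ih i' (mem_Iio.1 hi')).1]
      exact hJ.proj_pair_comm _ _
    rw [hpair]
    -- the projection of `J gᵢ` onto `f*_{2i}` vanishes
    have hperp : ⟪gramSchmidt ℝ f (evenIdx i), J (g i)⟫ = 0 := by
      have hg : g i = gramSchmidt ℝ f (evenIdx i) + ∑ i' ∈ Iio i,
          (proj (gramSchmidt ℝ f (evenIdx i')) (g i) + proj (J (gramSchmidt ℝ f (evenIdx i'))) (g i)) := by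
        rw [hE]; abel
      rw [hg, map_add, inner_add_right, real_inner_comm, hJ.skew, zero_add, map_sum, inner_sum]
      refine Finset.sum_eq_zero fun i' hi' => ?_
      have hne : evenIdx i ≠ evenIdx i' := by
        intro h; have := congrArg Fin.val h; simp [evenIdx] at this
        exact (mem_Iio.1 hi').ne' (Fin.ext this)
      have hne' : evenIdx i ≠ oddIdx i' := by
        intro h; have := congrArg Fin.val h; simp [evenIdx, oddIdx] at this; omega
      refine inner_map_proj_pair_eq_zero hJ (gramSchmidt_orthogonal ℝ f hne) ?_ (g i)
      rw [← (ih i' (mem_Iio.1 hi')).1]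
      exact gramSchmidt_orthogonal ℝ f hne'
    rw [proj, hperp, zero_div, zero_smul, zero_add, hE, map_sub]

/-- The odd Gram–Schmidt vectors: `f*_{2i+1} = J f*_{2i}`. [folklore] -/
theorem gramSchmidt_dbl_oddIdx (hJ : IsComplexStructure J) (g : Fin n → V) (i : Fin n) :
    gramSchmidt ℝ (dbl J g) (oddIdx i) = J (gramSchmidt ℝ (dbl J g) (evenIdx i)) :=
  (gramSchmidt_dbl hJ g i).1

/-- The even Gram–Schmidt vectors: `f*_{2i} = gᵢ - ∑_{i'<i} (P_{f*_{2i'}} + P_{J f*_{2i'}}) gᵢ`.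
[folklore] -/
theorem gramSchmidt_dbl_evenIdx (hJ : IsComplexStructure J) (g : Fin n → V) (i : Fin n) :
    gramSchmidt ℝ (dbl J g) (evenIdx i) = g i - ∑ i' ∈ Iio i,
      (proj (gramSchmidt ℝ (dbl J g) (evenIdx i')) (g i) +
        proj (J (gramSchmidt ℝ (dbl J g) (evenIdx i'))) (g i)) :=
  (gramSchmidt_dbl hJ g i).2

/-- The norms pair up: `‖f*_{2i+1}‖ = ‖f*_{2i}‖`. [folklore] -/
theorem norm_gramSchmidt_dbl_oddIdx (hJ : IsComplexStructure J) (g : Fin n → V) (i : Fin n) :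
    ‖gramSchmidt ℝ (dbl J g) (oddIdx i)‖ = ‖gramSchmidt ℝ (dbl J g) (evenIdx i)‖ := by
  rw [gramSchmidt_dbl_oddIdx hJ, hJ.norm_map]

end Skew

/-! ### The realification of `ℂᵐ` -/

section Realify

variable {m n : ℕ}

/-- The realification `ℂᵐ → ℝ^{m+m}`: real parts in the first `m` coordinates, imaginary parts in
the last `m` (through `finSumFinEquiv`). [folklore] -/
noncomputable def realify (v : EuclideanSpace ℂ (Fin m)) : EuclideanSpace ℝ (Fin (m + m)) :=
  WithLp.toLp 2 fun t => Sum.elim (fun r => (v r).re) (fun r => (v r).im) (finSumFinEquiv.symm t)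

/-- Multiplication by `i` on the realification: `(re, im) ↦ (-im, re)`, as a function. [folklore] -/
noncomputable def mulIFun (x : EuclideanSpace ℝ (Fin (m + m))) : EuclideanSpace ℝ (Fin (m + m)) :=
  WithLp.toLp 2 fun t => Sum.elim (fun r => -x (finSumFinEquiv (Sum.inr r)))
    (fun r => x (finSumFinEquiv (Sum.inl r))) (finSumFinEquiv.symm t)

/-- Coordinates of `realify`: real parts. [folklore] -/
theorem realify_inl (v : EuclideanSpace ℂ (Fin m)) (r : Fin m) :
    realify v (finSumFinEquiv (Sum.inl r)) = (v r).re := by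
  show Sum.elim (fun r => (v r).re) (fun r => (v r).im) (finSumFinEquiv.symm (finSumFinEquiv (Sum.inl r))) = _
  rw [Equiv.symm_apply_apply]; rfl

/-- Coordinates of `realify`: imaginary parts. [folklore] -/
theorem realify_inr (v : EuclideanSpace ℂ (Fin m)) (r : Fin m) :
    realify v (finSumFinEquiv (Sum.inr r)) = (v r).im := by
  show Sum.elim (fun r => (v r).re) (fun r => (v r).im) (finSumFinEquiv.symm (finSumFinEquiv (Sum.inr r))) = _
  rw [Equiv.symm_apply_apply]; rfl

/-- Coordinates of `mulIFun`. [folklore] -/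
theorem mulIFun_inl (x : EuclideanSpace ℝ (Fin (m + m))) (r : Fin m) :
    mulIFun x (finSumFinEquiv (Sum.inl r)) = -x (finSumFinEquiv (Sum.inr r)) := by
  show Sum.elim (fun r => -x (finSumFinEquiv (Sum.inr r))) (fun r => x (finSumFinEquiv (Sum.inl r)))
    (finSumFinEquiv.symm (finSumFinEquiv (Sum.inl r))) = _
  rw [Equiv.symm_apply_apply]; rfl

/-- Coordinates of `mulIFun`. [folklore] -/
theorem mulIFun_inr (x : EuclideanSpace ℝ (Fin (m + m))) (r : Fin m) :
    mulIFun x (finSumFinEquiv (Sum.inr r)) = x (finSumFinEquiv (Sum.inl r)) := by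
  show Sum.elim (fun r => -x (finSumFinEquiv (Sum.inr r))) (fun r => x (finSumFinEquiv (Sum.inl r)))
    (finSumFinEquiv.symm (finSumFinEquiv (Sum.inr r))) = _
  rw [Equiv.symm_apply_apply]; rfl

/-- Extensionality through the two halves of the coordinates. [folklore] -/
theorem ext_sum {x y : EuclideanSpace ℝ (Fin (m + m))}
    (h1 : ∀ r, x (finSumFinEquiv (Sum.inl r)) = y (finSumFinEquiv (Sum.inl r)))
    (h2 : ∀ r, x (finSumFinEquiv (Sum.inr r)) = y (finSumFinEquiv (Sum.inr r))) : x = y := by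
  ext t
  rcases finSumFinEquiv.surjective t with ⟨s, rfl⟩
  rcases s with r | r
  · exact h1 r
  · exact h2 r

/-- Multiplication by `i` on the realification, as a real-linear map. [folklore] -/
noncomputable def mulI : EuclideanSpace ℝ (Fin (m + m)) →ₗ[ℝ] EuclideanSpace ℝ (Fin (m + m)) where
  toFun := mulIFun
  map_add' x y := by
    refine ext_sum (fun r => ?_) (fun r => ?_)
    · rw [PiLp.add_apply, mulIFun_inl, mulIFun_inl, mulIFun_inl, PiLp.add_apply]; ring
    · rw [PiLp.add_apply, mulIFun_inr, mulIFun_inr, mulIFun_inr, PiLp.add_apply]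
  map_smul' c x := by
    refine ext_sum (fun r => ?_) (fun r => ?_)
    · rw [PiLp.smul_apply, mulIFun_inl, RingHom.id_apply, PiLp.smul_apply, mulIFun_inl, smul_eq_mul,
        smul_eq_mul]; ring
    · rw [PiLp.smul_apply, mulIFun_inr, RingHom.id_apply, PiLp.smul_apply, mulIFun_inr]

/-- Coordinates of `mulI`. [folklore] -/
theorem mulI_inl (x : EuclideanSpace ℝ (Fin (m + m))) (r : Fin m) :
    mulI x (finSumFinEquiv (Sum.inl r)) = -x (finSumFinEquiv (Sum.inr r)) := mulIFun_inl x r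

/-- Coordinates of `mulI`. [folklore] -/
theorem mulI_inr (x : EuclideanSpace ℝ (Fin (m + m))) (r : Fin m) :
    mulI x (finSumFinEquiv (Sum.inr r)) = x (finSumFinEquiv (Sum.inl r)) := mulIFun_inr x r

/-- Sums over `Fin (m + m)` split into the two halves. [folklore] -/
theorem sum_fin_add_eq {M : Type*} [AddCommMonoid M] (F : Fin (m + m) → M) :
    ∑ t, F t = ∑ r : Fin m, F (finSumFinEquiv (Sum.inl r)) + ∑ r : Fin m, F (finSumFinEquiv (Sum.inr r)) := by
  rw [← Fintype.sum_equiv finSumFinEquiv (fun s => F (finSumFinEquiv s)) F (fun _ => rfl),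
    Fintype.sum_sum_type]

/-- `realify` is additive. [folklore] -/
theorem realify_add (u v : EuclideanSpace ℂ (Fin m)) : realify (u + v) = realify u + realify v := by
  refine ext_sum (fun r => ?_) (fun r => ?_)
  · rw [PiLp.add_apply, realify_inl, realify_inl, realify_inl, PiLp.add_apply, Complex.add_re]
  · rw [PiLp.add_apply, realify_inr, realify_inr, realify_inr, PiLp.add_apply, Complex.add_im]

/-- `realify` is subtractive. [folklore] -/
theorem realify_sub (u v : EuclideanSpace ℂ (Fin m)) : realify (u - v) = realify u - realify v := by
  refine ext_sum (fun r => ?_) (fun r => ?_)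
  · rw [PiLp.sub_apply, realify_inl, realify_inl, realify_inl, PiLp.sub_apply, Complex.sub_re]
  · rw [PiLp.sub_apply, realify_inr, realify_inr, realify_inr, PiLp.sub_apply, Complex.sub_im]

/-- `realify 0 = 0`. [folklore] -/
theorem realify_zero : realify (0 : EuclideanSpace ℂ (Fin m)) = 0 := by
  refine ext_sum (fun r => ?_) (fun r => ?_)
  · rw [realify_inl]; rfl
  · rw [realify_inr]; rfl

/-- `realify` of a finite sum. [folklore] -/
theorem realify_sum {ι : Type*} (s : Finset ι) (v : ι → EuclideanSpace ℂ (Fin m)) :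
    realify (∑ i ∈ s, v i) = ∑ i ∈ s, realify (v i) := by
  classical
  induction s using Finset.induction_on with
  | empty => rw [Finset.sum_empty, Finset.sum_empty, realify_zero]
  | insert a s ha ih => rw [Finset.sum_insert ha, Finset.sum_insert ha, realify_add, ih]

/-- `realify` of a complex multiple: `realify (c • v) = re c • realify v + im c • mulI (realify v)`.
[folklore] -/
theorem realify_smul (c : ℂ) (v : EuclideanSpace ℂ (Fin m)) :
    realify (c • v) = c.re • realify v + c.im • mulI (realify v) := by
  refine ext_sum (fun r => ?_) (fun r => ?_)
  · simp only [PiLp.add_apply, PiLp.smul_apply, realify_inl, realify_inr, mulI_inl, smul_eq_mul,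
      Complex.mul_re]
    ring
  · simp only [PiLp.add_apply, PiLp.smul_apply, realify_inl, realify_inr, mulI_inr, smul_eq_mul,
      Complex.mul_im]

/-- **Multiplication by `i` is `mulI` after realification.** [folklore] -/
theorem realify_I_smul (v : EuclideanSpace ℂ (Fin m)) : realify (Complex.I • v) = mulI (realify v) := by
  rw [realify_smul, Complex.I_re, Complex.I_im, zero_smul, one_smul, zero_add]

/-- **`realify` turns the real part of the Hermitian product into the real inner product**:
`⟪realify u, realify v⟫ = re ⟪u, v⟫_ℂ`. [folklore] -/
theorem inner_realify (u v : EuclideanSpace ℂ (Fin m)) :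
    inner ℝ (realify u) (realify v) = (inner ℂ u v).re := by
  rw [PiLp.inner_apply, PiLp.inner_apply, Complex.re_sum, sum_fin_add_eq]
  simp only [realify_inl, realify_inr, RCLike.inner_apply, RCLike.conj_to_real]
  rw [← Finset.sum_add_distrib]
  refine Finset.sum_congr rfl fun r _ => ?_
  rw [Complex.mul_re, Complex.conj_re, Complex.conj_im]
  ring

/-- `⟪mulI x, mulI y⟫ = ⟪x, y⟫`. [folklore] -/
theorem inner_mulI_mulI (x y : EuclideanSpace ℝ (Fin (m + m))) :
    inner ℝ (mulI x) (mulI y) = inner ℝ x y := by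
  rw [PiLp.inner_apply, PiLp.inner_apply, sum_fin_add_eq, sum_fin_add_eq]
  simp only [mulI_inl, mulI_inr, RCLike.inner_apply, RCLike.conj_to_real]
  rw [add_comm]
  congr 1
  refine Finset.sum_congr rfl fun r _ => ?_
  ring

/-- `⟪mulI x, x⟫ = 0`. [folklore] -/
theorem inner_mulI_self (x : EuclideanSpace ℝ (Fin (m + m))) : inner ℝ (mulI x) x = 0 := by
  rw [PiLp.inner_apply, sum_fin_add_eq]
  simp only [mulI_inl, mulI_inr, RCLike.inner_apply, RCLike.conj_to_real]
  rw [← Finset.sum_add_distrib]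
  exact Finset.sum_eq_zero fun r _ => by ring

/-- **`mulI` is a compatible complex structure on `ℝ^{m+m}`.** [folklore] -/
theorem isComplexStructure_mulI : IsComplexStructure (mulI (m := m)) :=
  ⟨inner_mulI_mulI, inner_mulI_self⟩

/-- `‖realify v‖ = ‖v‖`. [folklore] -/
theorem norm_realify (v : EuclideanSpace ℂ (Fin m)) : ‖realify v‖ = ‖v‖ := by
  have h1 : ‖realify v‖ ^ 2 = ‖v‖ ^ 2 := by
    rw [← real_inner_self_eq_norm_sq, inner_realify, ← inner_self_eq_norm_sq (𝕜 := ℂ)]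
    rfl
  nlinarith [norm_nonneg (realify v), norm_nonneg v]

/-- **Complex projections realify to projection pairs**:
`realify ((⟪w, x⟫_ℂ/‖w‖²) • w) = P_{realify w} (realify x) + P_{mulI (realify w)} (realify x)`.
[folklore] -/
theorem realify_proj (w x : EuclideanSpace ℂ (Fin m)) :
    realify ((inner ℂ w x / ((‖w‖ : ℂ)) ^ 2) • w) =
      proj (realify w) (realify x) + proj (mulI (realify w)) (realify x) := by
  have hre : (inner ℂ w x / ((‖w‖ : ℂ)) ^ 2).re = (inner ℂ w x).re / ‖w‖ ^ 2 := by
    rw [← Complex.ofReal_pow, Complex.div_ofReal_re]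
  have him : (inner ℂ w x / ((‖w‖ : ℂ)) ^ 2).im = (inner ℂ w x).im / ‖w‖ ^ 2 := by
    rw [← Complex.ofReal_pow, Complex.div_ofReal_im]
  have h1 : inner ℝ (realify w) (realify x) = (inner ℂ w x).re := inner_realify w x
  have h2 : inner ℝ (mulI (realify w)) (realify x) = (inner ℂ w x).im := by
    rw [← realify_I_smul, inner_realify, inner_smul_left, Complex.conj_I]
    simp
  rw [realify_smul, hre, him, proj, proj, (isComplexStructure_mulI).norm_map, norm_realify, h1, h2]

/-- **Complex Gram–Schmidt is real Gram–Schmidt of the doubled realified family**: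
`realify (g*ᵢ) = f*_{2i}` for `f = (realify g₀, mulI (realify g₀), realify g₁, …)`. Strong
induction on `i`, through the even-vector formula `gramSchmidt_dbl_evenIdx` and `realify_proj`.
[folklore] -/
theorem realify_gramSchmidt (g : Fin n → EuclideanSpace ℂ (Fin m)) (i : Fin n) :
    realify (gramSchmidt ℂ g i) = gramSchmidt ℝ (dbl mulI (fun i => realify (g i))) (evenIdx i) := by
  induction i using WellFoundedLT.induction with
  | ind i ih =>
    rw [gramSchmidt_dbl_evenIdx isComplexStructure_mulI]
    have hdef : gramSchmidt ℂ g i = g i - ∑ i' ∈ Iio i,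
        (inner ℂ (gramSchmidt ℂ g i') (g i) / ((‖gramSchmidt ℂ g i'‖ : ℂ)) ^ 2) • gramSchmidt ℂ g i' := by
      rw [eq_sub_iff_add_eq]
      exact (gramSchmidt_def'' ℂ g i).symm
    rw [hdef, realify_sub, realify_sum]
    congr 1
    refine Finset.sum_congr rfl fun i' hi' => ?_
    rw [realify_proj, ih i' (mem_Iio.1 hi')]

end Realify

end Literature.Analysis.Matrix
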